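import Mathlib
import Summits.KontsevichZagierPeriods.Zeta5Search.CoefficientClassBounds
import HarnessLib

/-!
# ζ(5) search — the PALINDROME BONUS at coefficient level: `wLBpal ≤ v_p(W(b))`, `uLBpal ≤ v_p(U(b))` — SKETCH (census g13)

Cell `pub-zeta5`, census seat generation 13 (planner-pub-zeta5-census-g13-0, 2026-08-20).  HONEST FRAMING: systematic search; no
irrationality claim unless certified.  A statement file staged for the typer / lead lane (census files no Lean; STRUCTURE.md §17.3).

WHAT.  The tree's PROVED class bounds `wLB ≤ v_p(W)`, `uLB ≤ v_p(U)` (`CoefficientClassBounds`, typer g8, p217368) use the row values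
`1` (single-pole class) and `s + E_x` (multipole class, `s = 3` for `W`, `s = 5` for `U`).  gen-2's paper recipe `PB'_s` (REPORT-gen2-g6
§0/§5, "T'_x = T_x + [≥ 2 poles ∧ Φ_x palindromic ∧ s + E_x odd]") adds ONE unit on a multipole class whose level configuration is
PALINDROMIC with `s + E_x` odd — the PALINDROME LEMMA (REPORT-gen2-g6 §4a: Theorem B gives `S_{x,s} = p^{s+E_x}(ḡ_x Ψ_s(Φ_x) + O(p))`,
and `Ψ_s(Φ_x) = 0` when `Φ_x(L−η) = ±Φ_x(η)` and `s + E_x` is odd, the leading digits cancelling in reflected pairs).  The tree already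
has every ingredient but the summed cancellation: `IsPalindromic`, `classConfig`, `classBound` (WITH the bonus, `ClusterValuation` §2),
Theorem B termwise (`leadingDigit_holds`), Theorems A/A′ (`clusterBound_holds`, `isolatedPoleIntegral_holds`).

WHY (census g13 ladder, exact step-function limits).  On the record ray the whole residue of the paper rung K beyond the tree rung M
(`λ_TM − λ_TMK = 1.650` nats/step at `X_K = 4`; `γ` 0.80128 → 0.81047) is THIS bonus: grafting it alone onto the tree rows reproduces
`λ_TMK` exactly (`TMp = TMK`), while K's other two differences from the tree rows buy nothing (single-pole value `max(s+E,0)`: 0 gain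
instances) or are not separable (K's pole-order filter grafted onto the tree rows is FALSE: 2,039 exact violations in 75,494).  EVIDENCE
for the statements below (exact `v_p` of the gen-1 dictionary forms): 2,000 random integer `b` in the polytope (`b₀ ≤ 44`, random
labelling), every prime `5 ≤ p ≤ 3b₀+8` with `p² > b₀+2`: 75,494 (coefficient, p) checks, 2,637 instances where the bonus RAISES the tree
bound (U 1,173 / W 1,464), 0 violations (`pub-zeta5-census/xsave/g13/palcheck_2000_b0le44_seed13.json`); the 36 ladder rays n ≤ 2:
see `mcheck_all.json` ("variants" → "p").  CONJECTURE with exact finite evidence — not a theorem.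
-/

open Finset

namespace Summit.KontsevichZagierPeriods.Zeta5Search.ClusterValuation

open Summit.KontsevichZagierPeriods.Zeta5Search.WedgeDictionary (coeffU coeffW coeffV pfData dOf)
open Summit.KontsevichZagierPeriods.Zeta5Search.CasoratianValuation (InPolytope)

/-- The class row list WITH the palindrome bonus: single-pole class `1`, multipole class `classBound b p x s`
(= `s + E_x + [IsPalindromic (classConfig b p x) ∧ Odd (s + E_x)]`, `ClusterValuation` §2). -/
def classRowListPal (b : ℕ → ℤ) (p s : ℕ) : List ℤ :=
  (List.range p).filterMap fun x =>
    if classPoleCount b p x = 1 then some 1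
    else if 2 ≤ classPoleCount b p x then some (classBound b p x s) else none

/-- **`wLBpal(b,p)`** = `min{1 [single], 3 + E_x + pal-bonus [multi], 0 [p > d+1]}` (`0` if there is no pole class). -/
def wLBpal (b : ℕ → ℤ) (p : ℕ) : ℤ :=
  ((classRowListPal b p 3 ++ (if dOf b + 1 < (p : ℤ) then [0] else [])).min?).getD 0

/-- **`uLBpal(b,p)`** = `min{1 [single], 5 + E_x + pal-bonus [multi], 0 [4p > 2d+3]}`. -/
def uLBpal (b : ℕ → ℤ) (p : ℕ) : ℤ :=
  ((classRowListPal b p 5 ++ (if 2 * dOf b + 3 < 4 * (p : ℤ) then [0] else [])).min?).getD 0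

/-- **PALINDROMIC CLASS BOUND for `W`** (census g13; CONJECTURE, exact evidence in the module docstring; paper source REPORT-gen2-g6
§4a palindrome lemma): same hypotheses as `wLB_le_padicValRat_coeffW`. -/
@[conjecture] def PalindromicClassBoundW : Prop :=
  ∀ (b : ℕ → ℤ) (p : ℕ), InPolytope b → p.Prime → 5 ≤ p → (b 0 + 2 : ℤ) < (p : ℤ) ^ 2 → coeffW b ≠ 0 →
    wLBpal b p ≤ padicValRat p (coeffW b)

/-- **PALINDROMIC CLASS BOUND for `U`** (census g13; CONJECTURE): same hypotheses as `uLB_le_padicValRat_coeffU`. -/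
@[conjecture] def PalindromicClassBoundU : Prop :=
  ∀ (b : ℕ → ℤ) (p : ℕ), InPolytope b → p.Prime → 5 ≤ p → (b 0 + 2 : ℤ) < (p : ℤ) ^ 2 → coeffU b ≠ 0 →
    uLBpal b p ≤ padicValRat p (coeffU b)

/-! ### Sanity: the bonus never lowers the tree bound; record instance -/

/-- the record dual vector at `n = 2`: `b = (82; 34, 32, 30, 28, 26, 24, 22)`. -/
def bRec2 : ℕ → ℤ := fun i => (([82, 34, 32, 30, 28, 26, 24, 22] : List ℤ).getD i 0)

/- at `p = 17` (`x = n/p = 2/17` in the band `[1/16, 1/4)` where the record's K-beyond-M residue lives) the bonus raises BOTH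
tree bounds by one: `wLB = -5 → wLBpal = -4`, `uLB = -3 → uLBpal = -2` (census g13 port values; exact `v₁₇(W) = -4`, `v₁₇(U) = -2`:
the bonus is TIGHT here). -/
#guard wLB bRec2 17 == -5 && wLBpal bRec2 17 == -4
#guard uLB bRec2 17 == -3 && uLBpal bRec2 17 == -2
/- the bonus never lowers the tree rows at this vector: `wLB ≤ wLBpal`, `uLB ≤ uLBpal` at every prime `5 ≤ p ≤ 254`. -/
#guard (List.range 250).all fun i => decide (wLB bRec2 (i + 5) ≤ wLBpal bRec2 (i + 5) ∧ uLB bRec2 (i + 5) ≤ uLBpal bRec2 (i + 5))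

end Summit.KontsevichZagierPeriods.Zeta5Search.ClusterValuation
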